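import Mathlib.Analysis.SpecialFunctions.Gaussian.FourierTransform
import Literature.Analysis.FunctionSpaces.BochnerProofs
import Literature.Analysis.FluidPDE.HardSphereDynamicsProofs
import Summits.AtomisticToContinuum.HydrodynamicLimit.Theorems.AntiMazurCoboundariesKineticWindowGronwallThermalScalingGibbs
import HarnessLib

/-!
# Gaussian quadratic exponential moments of the homogeneous local Gibbs law (helper, layer 4: statics)

Crux `Summit.AtomisticToContinuum.HydrodynamicLimit.Theses.AntiMazurCoboundaries.KineticWindowGronwall`
(stmt-AtomisticToContinuum-9282), line `dlr-block-transfer` v6, helper stub `stub_gaussianQuadraticMoment` of the lead's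
stub `stub_frameCovariance` (frame covariance of the kinetic input). The Galilean boost turns a static test function
`φ(x)` into a moving one `φ(x + s u₀)`, `s ≤ h → 0`; the error of freezing it is `≤ η κ Σᵢ (1 + ‖vᵢ‖²/θ)` (quadratic
growth in the velocities) and is absorbed by Cauchy–Schwarz against the STATIC quadratic exponential moment of the
homogeneous local Gibbs law `G_N(a, 0, θ) = localGibbsLaw σ (fun _ => a) (fun _ => 0) (fun _ => θ) N Φ` proved here:

`∫⁻ exp(λ Σᵢ ‖vᵢ‖²) dG_N(a, 0, θ) ≤ ((1 − 2λθ)^{−3/2})^{N+1}`  (`θ > 0`, `λθ < 1/2`; `GaussianQuadraticMoment`,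
`stub_gaussianQuadraticMoment`), with EQUALITY when `G_N` is a probability measure
(`lintegral_exp_quadratic_localGibbsLaw_eq`).

PROOF. (i) One particle: for `v ∼ N(0, θ I_d)` (`gaussMeasure 0 θ`, whose Lebesgue density is the local Maxwellian
`M_{1,0,θ}`, `withDensity_localMaxwellian_eq_gaussMeasure`) completing the square gives
`M_{1,0,θ}(v) e^{λ‖v‖²} = (2πθ)^{-d/2} e^{-(1/(2θ) − λ)‖v‖²}`, and the Gaussian integral
`∫ e^{-b‖v‖²} dv = (π/b)^{d/2}` (Mathlib `GaussianFourier.integral_rexp_neg_mul_sq_norm`) with `b = 1/(2θ) − λ > 0`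
yields `E e^{λ‖v‖²} = (1 − 2λθ)^{−d/2}` (`lintegral_exp_mul_sq_norm_gaussMeasure_finrank`, and `d = 3`:
`lintegral_exp_mul_sq_norm_gaussMeasure`). (ii) `N + 1` particles: by the rung-0 product structure
`localGibbsMeasure_rung0_eq_map` (`HardSphereUniformGas`) the flow-free law at activity `a ≥ 0` is
`zipConfig_# (posGibbsMeasure ⊗ ⊗ᵢ N(0, θ))`; the weight depends on the velocities only, so the integral is
`posGibbsMeasure(univ) · ∏ᵢ E e^{λ‖vᵢ‖²}` (Tonelli over `Fin (N+1)`, `lintegral_fintype_prod_eq_prod'`), and the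
configurational Gibbs measure has total mass `Ξ⁻¹ Ξ ≤ 1` (`= 1` if the hard cores fit, the zero measure otherwise;
`posGibbsMeasure_univ_le_one`). A non-zero activity cancels from the canonical density
(`KineticWindowGronwallNegative.localGibbsLaw_const_activity`), the zero activity gives the zero law
(`KineticWindowGronwallThermalScaling.localGibbsLaw_zero_activity`), so the bound holds for EVERY `a : ℝ`.
(iii) Dynamics: the kinetic energy `½ Σᵢ ‖vᵢ‖²` is conserved along good orbits
(`IsHardSphereTrajectory.configEnergy_eq_holds`), so the window average `h⁻¹ ∫₀ʰ λ Σᵢ ‖vᵢ(s)‖² ds` equals its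
time-`0` value on the good set (`window_avg_sum_norm_sq_eq`), which carries full `G_N`-measure
(`ae_mem_good_localGibbsLaw`); hence the WINDOW version of the bound (`lintegral_exp_window_quadratic_le`, every
`h : ℝ`) with no Jensen inequality in time.

Folklore (Gaussian moment generating function of `‖v‖²`, i.e. the `χ²_d` law; Spohn 1991, Part I §2.3 for the local
equilibrium states). No Theses declaration is concluded; no named fact is used.
-/

noncomputable section

open Set Function MeasureTheory ProbabilityTheory Real
open scoped ENNReal
open Literature.Analysis.FluidPDE Literature.MathematicalPhysics.KineticTheory

namespace Summit.AtomisticToContinuum.HydrodynamicLimit.Theorems.KineticWindowGronwallQuadraticMoment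

/-- STATIC GAUSSIAN QUADRATIC EXPONENTIAL MOMENT UNDER THE HOMOGENEOUS LOCAL GIBBS LAW. -/
def GaussianQuadraticMoment : Prop :=
  ∀ (σ a θ lam : ℝ) (N : ℕ) (Φ : HardSphereFlow (Torus.geometry (Fin 3)) (hsDiameter σ N) (N + 1)),
    0 < θ → 0 ≤ lam → lam * θ < 1 / 2 →
    ∫⁻ z, ENNReal.ofReal (Real.exp (lam * ∑ i, ‖(z i).2‖ ^ 2))
        ∂(localGibbsLaw σ (fun _ => a) (fun _ => (0 : V3)) (fun _ => θ) N Φ) ≤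
      ENNReal.ofReal (((1 - 2 * lam * θ) ^ (-(3 / 2 : ℝ))) ^ (N + 1))

/-! ### One particle: the quadratic exponential moment of an isotropic Gaussian -/

section Gauss

variable {E : Type*} [NormedAddCommGroup E] [InnerProductSpace ℝ E] [FiniteDimensional ℝ E]
  [MeasurableSpace E] [BorelSpace E]

omit [FiniteDimensional ℝ E] [MeasurableSpace E] [BorelSpace E] in
/-- Completing the square: `M_{1,0,θ}(v) e^{λ‖v‖²} = (2πθ)^{-d/2} e^{-(1/(2θ) − λ)‖v‖²}`. [folklore] -/
theorem localMaxwellian_mul_exp_mul_sq_norm (θ lam : ℝ) (v : E) :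
    localMaxwellian 1 θ (0 : E) v * Real.exp (lam * ‖v‖ ^ 2) =
      (2 * π * θ) ^ (-(Module.finrank ℝ E : ℝ) / 2) * Real.exp (-(1 / (2 * θ) - lam) * ‖v‖ ^ 2) := by
  rw [localMaxwellian, one_mul, sub_zero, mul_assoc, ← Real.exp_add]
  congr 2
  ring

/-- For `θ > 0` and `λθ < 1/2` the Gaussian rate `b = 1/(2θ) − λ` is positive. [folklore] -/
theorem gaussRate_pos {θ lam : ℝ} (hθ : 0 < θ) (hlam : lam * θ < 1 / 2) : 0 < 1 / (2 * θ) - lam := by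
  rw [sub_pos, lt_div_iff₀ (by positivity)]
  linarith

/-- The Gaussian normalisation identity `(2πθ)^{-r} (π / (1/(2θ) − λ))^{r} = (1 − 2λθ)^{-r}` (`θ > 0`,
`λθ < 1/2`). [folklore] -/
theorem gauss_quadratic_const {θ lam : ℝ} (hθ : 0 < θ) (hlam : lam * θ < 1 / 2) (r : ℝ) :
    (2 * π * θ) ^ (-r) * (π / (1 / (2 * θ) - lam)) ^ r = (1 - 2 * lam * θ) ^ (-r) := by
  have h2πθ : 0 < 2 * π * θ := by positivity
  have hq : 0 < 1 - 2 * lam * θ := by linarith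
  have hb : 1 / (2 * θ) - lam = (1 - 2 * lam * θ) / (2 * θ) := by
    field_simp
  have hdiv : π / (1 / (2 * θ) - lam) = (2 * π * θ) / (1 - 2 * lam * θ) := by
    rw [hb, div_div_eq_mul_div]
    ring
  rw [hdiv, Real.div_rpow h2πθ.le hq.le, Real.rpow_neg h2πθ.le, Real.rpow_neg hq.le, div_eq_mul_inv,
    ← mul_assoc, inv_mul_cancel₀ (Real.rpow_pos_of_pos h2πθ r).ne', one_mul]

omit [InnerProductSpace ℝ E] [FiniteDimensional ℝ E] in
/-- The quadratic exponential weight `v ↦ e^{λ‖v‖²}` is measurable (as an `ℝ≥0∞`-valued function). [folklore] -/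
theorem measurable_ofReal_exp_mul_sq_norm (lam : ℝ) :
    Measurable fun v : E => ENNReal.ofReal (Real.exp (lam * ‖v‖ ^ 2)) := by
  refine Measurable.ennreal_ofReal ?_
  exact (Real.continuous_exp.comp (by fun_prop)).measurable

/-- **Quadratic exponential moment of the isotropic Gaussian** (moment generating function of `‖v‖²`, the
`χ²_d` law): for `v ∼ N(0, θ I_d)`, `θ > 0`, `λθ < 1/2`, `E e^{λ‖v‖²} = (1 − 2λθ)^{−d/2}`, `d = dim E`. [folklore] -/
theorem lintegral_exp_mul_sq_norm_gaussMeasure_finrank {θ lam : ℝ} (hθ : 0 < θ) (hlam : lam * θ < 1 / 2) :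
    ∫⁻ v, ENNReal.ofReal (Real.exp (lam * ‖v‖ ^ 2)) ∂(gaussMeasure (0 : E) θ) =
      ENNReal.ofReal ((1 - 2 * lam * θ) ^ (-(Module.finrank ℝ E : ℝ) / 2)) := by
  have hbpos : 0 < 1 / (2 * θ) - lam := gaussRate_pos hθ hlam
  have hC0 : 0 ≤ (2 * π * θ) ^ (-(Module.finrank ℝ E : ℝ) / 2) := Real.rpow_nonneg (by positivity) _
  have hMm : Measurable fun v : E => ENNReal.ofReal (localMaxwellian 1 θ (0 : E) v) :=
    (continuous_localMaxwellian 1 θ (0 : E)).measurable.ennreal_ofReal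
  have hint : Integrable (fun v : E => Real.exp (-(1 / (2 * θ) - lam) * ‖v‖ ^ 2)) :=
    Literature.Analysis.FunctionSpaces.integrable_rexp_neg_mul_sq_norm hbpos
  rw [← withDensity_localMaxwellian_eq_gaussMeasure hθ (0 : E),
    lintegral_withDensity_eq_lintegral_mul _ hMm (measurable_ofReal_exp_mul_sq_norm lam)]
  calc _
      = ∫⁻ v : E, ENNReal.ofReal ((2 * π * θ) ^ (-(Module.finrank ℝ E : ℝ) / 2)) *
          ENNReal.ofReal (Real.exp (-(1 / (2 * θ) - lam) * ‖v‖ ^ 2)) := by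
        refine lintegral_congr fun v => ?_
        rw [Pi.mul_apply, ← ENNReal.ofReal_mul (localMaxwellian_nonneg zero_le_one hθ.le _ _),
          localMaxwellian_mul_exp_mul_sq_norm, ENNReal.ofReal_mul hC0]
    _ = ENNReal.ofReal ((2 * π * θ) ^ (-(Module.finrank ℝ E : ℝ) / 2)) *
          ENNReal.ofReal (∫ v : E, Real.exp (-(1 / (2 * θ) - lam) * ‖v‖ ^ 2)) := by
        rw [lintegral_const_mul' _ _ ENNReal.ofReal_ne_top,
          ofReal_integral_eq_lintegral_ofReal hint (ae_of_all _ fun v => (Real.exp_pos _).le)]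
    _ = ENNReal.ofReal ((1 - 2 * lam * θ) ^ (-(Module.finrank ℝ E : ℝ) / 2)) := by
        rw [← ENNReal.ofReal_mul hC0, GaussianFourier.integral_rexp_neg_mul_sq_norm hbpos, neg_div,
          gauss_quadratic_const hθ hlam]

end Gauss

/-- The dimension bookkeeping `-(dim ℝ³)/2 = -3/2`. [folklore] -/
theorem neg_finrank_V3_div_two : -(Module.finrank ℝ V3 : ℝ) / 2 = -(3 / 2 : ℝ) := by
  rw [finrank_euclideanSpace_fin]
  norm_num

/-- **One particle in `ℝ³`**: for `v ∼ N(0, θ I₃)`, `θ > 0`, `λθ < 1/2`,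
`∫⁻ e^{λ‖v‖²} dN(0, θ I₃) = (1 − 2λθ)^{−3/2}`. [folklore] -/
theorem lintegral_exp_mul_sq_norm_gaussMeasure {θ lam : ℝ} (hθ : 0 < θ) (hlam : lam * θ < 1 / 2) :
    ∫⁻ v, ENNReal.ofReal (Real.exp (lam * ‖v‖ ^ 2)) ∂(gaussMeasure (0 : V3) θ) =
      ENNReal.ofReal ((1 - 2 * lam * θ) ^ (-(3 / 2 : ℝ))) := by
  rw [lintegral_exp_mul_sq_norm_gaussMeasure_finrank hθ hlam, neg_finrank_V3_div_two]

/-! ### `N + 1` particles: i.i.d. Maxwellian velocities and the configurational factor -/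

section Gibbs

/-- The `n`-particle quadratic exponential weight `v ↦ e^{λ Σᵢ ‖vᵢ‖²}` factorises over the particles. [folklore] -/
theorem ofReal_exp_mul_sum_sq_norm {n : ℕ} (lam : ℝ) (v : Fin n → V3) :
    ENNReal.ofReal (Real.exp (lam * ∑ i, ‖v i‖ ^ 2)) = ∏ i, ENNReal.ofReal (Real.exp (lam * ‖v i‖ ^ 2)) := by
  rw [Finset.mul_sum, Real.exp_sum, ENNReal.ofReal_prod_of_nonneg fun i _ => (Real.exp_pos _).le]

/-- The `n`-particle quadratic exponential weight is measurable in the velocities. [folklore] -/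
theorem measurable_ofReal_exp_mul_sum_sq_norm {n : ℕ} (lam : ℝ) :
    Measurable fun v : Fin n → V3 => ENNReal.ofReal (Real.exp (lam * ∑ i, ‖v i‖ ^ 2)) := by
  refine Measurable.ennreal_ofReal ?_
  exact (Real.continuous_exp.comp (by fun_prop)).measurable

/-- **i.i.d. Maxwellian velocities**: `∫⁻ e^{λ Σᵢ ‖vᵢ‖²} d(⊗ᵢ N(0, θ I₃)) = ((1 − 2λθ)^{−3/2})^n` (Tonelli over
`Fin n` and the one-particle moment). [folklore] -/
theorem lintegral_exp_mul_sum_sq_norm_pi_gaussMeasure {θ lam : ℝ} (hθ : 0 < θ) (hlam : lam * θ < 1 / 2)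
    (n : ℕ) :
    ∫⁻ v, ENNReal.ofReal (Real.exp (lam * ∑ i, ‖v i‖ ^ 2)) ∂(Measure.pi fun _ : Fin n => gaussMeasure (0 : V3) θ) =
      ENNReal.ofReal (((1 - 2 * lam * θ) ^ (-(3 / 2 : ℝ))) ^ n) := by
  have hq : 0 ≤ (1 - 2 * lam * θ) ^ (-(3 / 2 : ℝ)) := Real.rpow_nonneg (by linarith) _
  simp_rw [ofReal_exp_mul_sum_sq_norm]
  rw [lintegral_fintype_prod_eq_prod' (fun _ : Fin n => gaussMeasure (0 : V3) θ)
      (f := fun _ x => ENNReal.ofReal (Real.exp (lam * ‖x‖ ^ 2))) (fun _ => measurable_ofReal_exp_mul_sq_norm lam)]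
  simp_rw [lintegral_exp_mul_sq_norm_gaussMeasure hθ hlam]
  rw [Finset.prod_const, Finset.card_univ, Fintype.card_fin, ENNReal.ofReal_pow hq]

/-- Integrating a function of the second coordinate against a product measure:
`∫⁻ g(p.2) d(μ ⊗ ν) = μ(univ) ∫⁻ g dν`. [folklore] -/
theorem lintegral_prod_snd_eq {α β : Type*} [MeasurableSpace α] [MeasurableSpace β] (μ : Measure α)
    (ν : Measure β) [SFinite ν] {g : β → ℝ≥0∞} (hg : Measurable g) :
    ∫⁻ p, g p.2 ∂(μ.prod ν) = μ univ * ∫⁻ y, g y ∂ν := by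
  rw [← lintegral_map hg measurable_snd, Measure.map_snd_prod, lintegral_smul_measure, smul_eq_mul]

variable {a₀ : T3 → ℝ}

/-- **The configurational Gibbs measure has total mass at most one**: `posGibbsMeasure(univ) = Ξ⁻¹ Ξ`, which is
`1` if `Ξ > 0` (the hard cores fit) and `0` otherwise (the junk zero measure). [folklore] -/
theorem posGibbsMeasure_univ_le_one (ha : Continuous a₀) (ha0 : ∀ x, 0 ≤ a₀ x) (ε : ℝ) (n : ℕ) :
    posGibbsMeasure a₀ ε n univ ≤ 1 := by
  have hP : 0 ≤ posPartition a₀ ε n := posPartition_nonneg ha0 ε n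
  rw [posGibbsMeasure, withDensity_apply _ MeasurableSet.univ, Measure.restrict_univ]
  simp_rw [ENNReal.ofReal_mul (inv_nonneg.2 hP)]
  rw [lintegral_const_mul' _ _ ENNReal.ofReal_ne_top, ← ofReal_posPartition ha ha0,
    ← ENNReal.ofReal_mul (inv_nonneg.2 hP), ← ENNReal.ofReal_one]
  refine ENNReal.ofReal_le_ofReal ?_
  rcases eq_or_ne (posPartition a₀ ε n) 0 with h | h
  · rw [h, mul_zero]
    exact zero_le_one
  · rw [inv_mul_cancel₀ h]

/-- **Static quadratic exponential moment of the flow-free homogeneous local Gibbs measure** (`a ≥ 0`, `θ > 0`,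
`λθ < 1/2`): `∫⁻ e^{λ Σᵢ ‖vᵢ‖²} dG_N(a, 0, θ) = posGibbsMeasure(univ) · ((1 − 2λθ)^{−3/2})^{N+1}` (rung-0 product
structure: positions integrate out to the total mass of the configurational factor). [folklore] -/
theorem lintegral_exp_quadratic_localGibbsMeasure (σ : ℝ) {a θ lam : ℝ} (ha : 0 ≤ a) (hθ : 0 < θ)
    (hlam : lam * θ < 1 / 2) (N : ℕ) :
    ∫⁻ z, ENNReal.ofReal (Real.exp (lam * ∑ i, ‖(z i).2‖ ^ 2))
        ∂(localGibbsMeasure σ (fun _ => a) (fun _ => (0 : V3)) (fun _ => θ) N) =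
      posGibbsMeasure (fun _ : T3 => a) (hsDiameter σ N) (N + 1) univ *
        ENNReal.ofReal (((1 - 2 * lam * θ) ^ (-(3 / 2 : ℝ))) ^ (N + 1)) := by
  have hz : MeasurableEmbedding
      (zipConfig : (Fin (N + 1) → T3) × (Fin (N + 1) → V3) → Config (N + 1) (Fin 3) T3) :=
    (MeasurableEquiv.arrowProdEquivProdArrow T3 V3 (Fin (N + 1))).symm.measurableEmbedding
  rw [localGibbsMeasure_rung0_eq_map σ ha hθ 0 N, hz.lintegral_map]
  change ∫⁻ p : (Fin (N + 1) → T3) × (Fin (N + 1) → V3), ENNReal.ofReal (Real.exp (lam * ∑ i, ‖p.2 i‖ ^ 2))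
      ∂((posGibbsMeasure (fun _ : T3 => a) (hsDiameter σ N) (N + 1)).prod
        (Measure.pi fun _ : Fin (N + 1) => gaussMeasure (0 : V3) θ)) = _
  rw [lintegral_prod_snd_eq _ _ (measurable_ofReal_exp_mul_sum_sq_norm lam),
    lintegral_exp_mul_sum_sq_norm_pi_gaussMeasure hθ hlam (N + 1)]

/-- The same as an unconditional BOUND for the flow-free measure (`a ≥ 0`): the configurational factor has mass
`≤ 1`. [folklore] -/
theorem lintegral_exp_quadratic_localGibbsMeasure_le (σ : ℝ) {a θ lam : ℝ} (ha : 0 ≤ a) (hθ : 0 < θ)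
    (hlam : lam * θ < 1 / 2) (N : ℕ) :
    ∫⁻ z, ENNReal.ofReal (Real.exp (lam * ∑ i, ‖(z i).2‖ ^ 2))
        ∂(localGibbsMeasure σ (fun _ => a) (fun _ => (0 : V3)) (fun _ => θ) N) ≤
      ENNReal.ofReal (((1 - 2 * lam * θ) ^ (-(3 / 2 : ℝ))) ^ (N + 1)) := by
  rw [lintegral_exp_quadratic_localGibbsMeasure σ ha hθ hlam N]
  calc _ ≤ 1 * ENNReal.ofReal (((1 - 2 * lam * θ) ^ (-(3 / 2 : ℝ))) ^ (N + 1)) := by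
        gcongr
        exact posGibbsMeasure_univ_le_one continuous_const (fun _ => ha) _ _
    _ = _ := one_mul _

/-- **STATIC QUADRATIC EXPONENTIAL MOMENT OF THE HOMOGENEOUS LOCAL GIBBS LAW, every activity** (`θ > 0`,
`λθ < 1/2`, any `a : ℝ`, any type-fixing flow `Φ`): `∫⁻ e^{λ Σᵢ ‖vᵢ‖²} dG_N(a, 0, θ) ≤ ((1 − 2λθ)^{−3/2})^{N+1}`.
For `a ≠ 0` the activity cancels from the canonical density (reduction to `a = 1`), for `a = 0` the law is zero.
[folklore] -/
theorem lintegral_exp_quadratic_localGibbsLaw_le (σ a : ℝ) {θ lam : ℝ} (hθ : 0 < θ) (hlam : lam * θ < 1 / 2)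
    (N : ℕ) (Φ : HardSphereFlow (Torus.geometry (Fin 3)) (hsDiameter σ N) (N + 1)) :
    ∫⁻ z, ENNReal.ofReal (Real.exp (lam * ∑ i, ‖(z i).2‖ ^ 2))
        ∂(localGibbsLaw σ (fun _ => a) (fun _ => (0 : V3)) (fun _ => θ) N Φ) ≤
      ENNReal.ofReal (((1 - 2 * lam * θ) ^ (-(3 / 2 : ℝ))) ^ (N + 1)) := by
  rcases eq_or_ne a 0 with ha | ha
  · subst ha
    rw [KineticWindowGronwallThermalScaling.localGibbsLaw_zero_activity, lintegral_zero_measure]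
    exact bot_le
  · rw [KineticWindowGronwallNegative.localGibbsLaw_const_activity ha, localGibbsLaw_eq]
    exact lintegral_exp_quadratic_localGibbsMeasure_le σ zero_le_one hθ hlam N

/-- **`stub_gaussianQuadraticMoment`: the registered statement `GaussianQuadraticMoment` holds** (the hypothesis
`0 ≤ λ` of the registered statement is not needed). [folklore] -/
theorem stub_gaussianQuadraticMoment : GaussianQuadraticMoment :=
  fun σ a _θ _lam N Φ hθ _ hlam => lintegral_exp_quadratic_localGibbsLaw_le σ a hθ hlam N Φ

/-- When the homogeneous local Gibbs law is a probability measure its configurational factor (at activity `1`) has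
total mass one. [folklore] -/
theorem posGibbsMeasure_univ_eq_one_of_isProbabilityMeasure (σ a : ℝ) {θ : ℝ} (hθ : 0 < θ) (u : V3) (N : ℕ)
    (Φ : HardSphereFlow (Torus.geometry (Fin 3)) (hsDiameter σ N) (N + 1))
    [hP : IsProbabilityMeasure (localGibbsLaw σ (fun _ => a) (fun _ => u) (fun _ => θ) N Φ)] :
    a ≠ 0 ∧ posGibbsMeasure (fun _ : T3 => (1 : ℝ)) (hsDiameter σ N) (N + 1) univ = 1 := by
  have ha : a ≠ 0 := by
    rintro rfl
    have h := hP.measure_univ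
    rw [KineticWindowGronwallThermalScaling.localGibbsLaw_zero_activity] at h
    exact zero_ne_one h
  refine ⟨ha, ?_⟩
  have h := hP.measure_univ
  rw [KineticWindowGronwallNegative.localGibbsLaw_const_activity ha, localGibbsLaw_eq,
    localGibbsMeasure_rung0_eq_map σ zero_le_one hθ u N, Measure.map_apply measurable_zipConfig MeasurableSet.univ,
    preimage_univ, ← univ_prod_univ, Measure.prod_prod,
    measure_univ (μ := Measure.pi fun _ : Fin (N + 1) => gaussMeasure u θ), mul_one] at h
  exact h

/-- **EQUALITY when `G_N` is a probability measure** (e.g. `σ ≤ 1/2`, `a > 0`, `isProbabilityMeasure_localGibbsLaw`;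
this is the situation of the kinetic hypothesis, which asserts `IsProbabilityMeasure G_N`):
`∫⁻ e^{λ Σᵢ ‖vᵢ‖²} dG_N(a, 0, θ) = ((1 − 2λθ)^{−3/2})^{N+1}` (`θ > 0`, `λθ < 1/2`). [folklore] -/
theorem lintegral_exp_quadratic_localGibbsLaw_eq (σ a : ℝ) {θ lam : ℝ} (hθ : 0 < θ) (hlam : lam * θ < 1 / 2)
    (N : ℕ) (Φ : HardSphereFlow (Torus.geometry (Fin 3)) (hsDiameter σ N) (N + 1))
    [IsProbabilityMeasure (localGibbsLaw σ (fun _ => a) (fun _ => (0 : V3)) (fun _ => θ) N Φ)] :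
    ∫⁻ z, ENNReal.ofReal (Real.exp (lam * ∑ i, ‖(z i).2‖ ^ 2))
        ∂(localGibbsLaw σ (fun _ => a) (fun _ => (0 : V3)) (fun _ => θ) N Φ) =
      ENNReal.ofReal (((1 - 2 * lam * θ) ^ (-(3 / 2 : ℝ))) ^ (N + 1)) := by
  obtain ⟨ha, h1⟩ := posGibbsMeasure_univ_eq_one_of_isProbabilityMeasure σ a hθ (0 : V3) N Φ
  rw [KineticWindowGronwallNegative.localGibbsLaw_const_activity ha, localGibbsLaw_eq,
    lintegral_exp_quadratic_localGibbsMeasure σ zero_le_one hθ hlam N, h1, one_mul]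

end Gibbs

/-! ### Dynamics: energy conservation freezes the quadratic weight along good orbits -/

section Dynamic

variable {d : Type*} [Fintype d] {X : Type*} [MeasureSpace X] [TopologicalSpace X] {G : Geometry d X} {ε : ℝ}
  {n : ℕ}

/-- **Energy conservation on good orbits**, in the form used by quadratic window functionals:
`Σᵢ ‖vᵢ(s)‖² = Σᵢ ‖vᵢ(0)‖²` for every `s` and every good initial datum
(`IsHardSphereTrajectory.configEnergy_eq_holds`, `HardSphereFlow.flow_zero`). [folklore] -/
theorem sum_norm_sq_flow_eq (Φ : HardSphereFlow G ε n) {z : Config n d X} (hz : z ∈ Φ.good) (s : ℝ) :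
    ∑ i, ‖(Φ.flow s z i).2‖ ^ 2 = ∑ i, ‖(z i).2‖ ^ 2 := by
  have h : configEnergy (Φ.flow s z) = configEnergy (Φ.flow 0 z) :=
    IsHardSphereTrajectory.configEnergy_eq_holds (Φ.isTrajectory z hz) s 0
  rw [Φ.flow_zero z hz] at h
  unfold configEnergy at h
  exact mul_left_cancel₀ (by norm_num) h

/-- **Window averages of the quadratic weight on good orbits** (`h ≠ 0`):
`h⁻¹ ∫₀ʰ λ Σᵢ ‖vᵢ(s)‖² ds = λ Σᵢ ‖vᵢ(0)‖²`. [folklore] -/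
theorem window_avg_sum_norm_sq_eq (Φ : HardSphereFlow G ε n) {z : Config n d X} (hz : z ∈ Φ.good) (lam : ℝ)
    {h : ℝ} (hh : h ≠ 0) :
    h⁻¹ * ∫ s in (0 : ℝ)..h, lam * ∑ i, ‖(Φ.flow s z i).2‖ ^ 2 = lam * ∑ i, ‖(z i).2‖ ^ 2 := by
  simp_rw [sum_norm_sq_flow_eq Φ hz]
  rw [intervalIntegral.integral_const, sub_zero, smul_eq_mul, ← mul_assoc, inv_mul_cancel₀ hh, one_mul]

/-- The same as an inequality valid for EVERY `h : ℝ` when `λ ≥ 0` (at `h = 0` the left-hand side is the junk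
value `0 ≤ λ Σᵢ ‖vᵢ‖²`). [folklore] -/
theorem window_avg_sum_norm_sq_le (Φ : HardSphereFlow G ε n) {z : Config n d X} (hz : z ∈ Φ.good) {lam : ℝ}
    (hlam : 0 ≤ lam) (h : ℝ) :
    h⁻¹ * ∫ s in (0 : ℝ)..h, lam * ∑ i, ‖(Φ.flow s z i).2‖ ^ 2 ≤ lam * ∑ i, ‖(z i).2‖ ^ 2 := by
  rcases eq_or_ne h 0 with rfl | hh
  · rw [inv_zero, zero_mul]
    exact mul_nonneg hlam (Finset.sum_nonneg fun i _ => sq_nonneg _)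
  · exact (window_avg_sum_norm_sq_eq Φ hz lam hh).le

end Dynamic

section Window

/-- **`G_N`-almost every configuration is good** for every hard-sphere flow `Φ` of the right type (the local
Gibbs law is absolutely continuous with respect to the Liouville measure, for which the good set is conull).
[folklore] -/
theorem ae_mem_good_localGibbsLaw (σ : ℝ) (a₀ : T3 → ℝ) (u₀ : T3 → V3) (θ₀ : T3 → ℝ) (N : ℕ)
    (Φ : HardSphereFlow (Torus.geometry (Fin 3)) (hsDiameter σ N) (N + 1)) :
    ∀ᵐ z ∂(localGibbsLaw σ a₀ u₀ θ₀ N Φ), z ∈ Φ.good := by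
  rw [localGibbsLaw_eq]
  exact (localGibbsMeasure_absolutelyContinuous σ a₀ u₀ θ₀ N Φ).ae_le Φ.ae_mem_good

/-- **Window functional = static functional** (`h ≠ 0`, every activity, every flow): under `G_N(a, 0, θ)` the
exponential moment of the window average `h⁻¹ ∫₀ʰ λ Σᵢ ‖vᵢ(s)‖² ds` is the static quadratic exponential moment
(energy conservation on the conull good set). [folklore] -/
theorem lintegral_exp_window_quadratic_eq (σ a θ lam : ℝ) (N : ℕ)
    (Φ : HardSphereFlow (Torus.geometry (Fin 3)) (hsDiameter σ N) (N + 1)) {h : ℝ} (hh : h ≠ 0) :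
    ∫⁻ z, ENNReal.ofReal (Real.exp (h⁻¹ * ∫ s in (0 : ℝ)..h, lam * ∑ i, ‖(Φ.flow s z i).2‖ ^ 2))
        ∂(localGibbsLaw σ (fun _ => a) (fun _ => (0 : V3)) (fun _ => θ) N Φ) =
      ∫⁻ z, ENNReal.ofReal (Real.exp (lam * ∑ i, ‖(z i).2‖ ^ 2))
        ∂(localGibbsLaw σ (fun _ => a) (fun _ => (0 : V3)) (fun _ => θ) N Φ) := by
  refine lintegral_congr_ae ?_
  filter_upwards [ae_mem_good_localGibbsLaw σ (fun _ => a) (fun _ => (0 : V3)) (fun _ => θ) N Φ] with z hz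
  rw [window_avg_sum_norm_sq_eq Φ hz lam hh]

/-- **THE WINDOW VERSION OF THE QUADRATIC EXPONENTIAL MOMENT BOUND** (every `h : ℝ`, every activity `a`, every flow
`Φ`; `θ > 0`, `0 ≤ λ`, `λθ < 1/2`):
`∫⁻ exp(h⁻¹ ∫₀ʰ λ Σᵢ ‖vᵢ(s)‖² ds) dG_N(a, 0, θ) ≤ ((1 − 2λθ)^{−3/2})^{N+1}` — no Jensen inequality in time is
needed, the window average being frozen at its initial value on good orbits. [folklore] -/
theorem lintegral_exp_window_quadratic_le (σ a : ℝ) {θ lam : ℝ} (hθ : 0 < θ) (hlam0 : 0 ≤ lam)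
    (hlam : lam * θ < 1 / 2) (N : ℕ) (Φ : HardSphereFlow (Torus.geometry (Fin 3)) (hsDiameter σ N) (N + 1))
    (h : ℝ) :
    ∫⁻ z, ENNReal.ofReal (Real.exp (h⁻¹ * ∫ s in (0 : ℝ)..h, lam * ∑ i, ‖(Φ.flow s z i).2‖ ^ 2))
        ∂(localGibbsLaw σ (fun _ => a) (fun _ => (0 : V3)) (fun _ => θ) N Φ) ≤
      ENNReal.ofReal (((1 - 2 * lam * θ) ^ (-(3 / 2 : ℝ))) ^ (N + 1)) := by
  refine le_trans (lintegral_mono_ae ?_) (lintegral_exp_quadratic_localGibbsLaw_le σ a hθ hlam N Φ)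
  filter_upwards [ae_mem_good_localGibbsLaw σ (fun _ => a) (fun _ => (0 : V3)) (fun _ => θ) N Φ] with z hz
  exact ENNReal.ofReal_le_ofReal (Real.exp_le_exp.2 (window_avg_sum_norm_sq_le Φ hz hlam0 h))

end Window

end Summit.AtomisticToContinuum.HydrodynamicLimit.Theorems.KineticWindowGronwallQuadraticMoment

end
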